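import Literature.MathematicalPhysics.QuantumManyBody.GroundStateFeynmanKacProofs
import Literature.MathematicalPhysics.QuantumManyBody.PeriodicFeynmanKacTrialState
import HarnessLib

/-!
# Route BECCutLineWeakDisorder — `WitnessTransfer`, IV: symmetric `C¹` near-minimisers close to
a ground-state candidate

Support file (does not close the item) for item stmt-AtomisticToContinuum-14978
(`Summit.AtomisticToContinuum.BoseEinsteinCondensation.Theses.BECCutLineWeakDisorder.WitnessTransfer`).
The library theorem `groundStateEnergy_le_ofReal_of_eigen` (`GroundStateFeynmanKacProofs.lean`,
Chung–Zhao's Prop 3.29 upper half in the tree's variational vocabulary) builds, from a continuous,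
nonnegative, permutation-symmetric `Ψ₀` vanishing off `Λ_L^N` with `∫Ψ₀² = 1` and the integrated
eigen-relation `e^{-λt} ≤ ⟨Ψ₀, e^{-tH_N}Ψ₀⟩`, symmetric `C¹` Dirichlet trial states
`c · trialFn L θ Ψ₀` with energy `≤ λ + ε`, but only returns the inequality
`groundStateEnergy ≤ λ`. The landscape transfer needs THE STATES, together with the facts that
`θ` can be taken in any prescribed eventually-true set as `θ → 1⁺` (to control the landscape
ratio by uniform convergence `trialFn L θ Ψ₀ → Ψ₀`) and that the normalising constant satisfies
`c² ≤ 1 + ε`. `exists_trialState_energy_le` is that refinement: the construction is replayed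
verbatim (the private helpers of the library file are re-proved here under new names, except the
two with public twins in `PeriodicFeynmanKacTrialState.lean`, which are imported).

## References

* K. L. Chung, Z. Zhao, *From Brownian Motion to Schrödinger's Equation* (1995), Thm 3.27,
  Prop 3.29 (81). [ChungZhao1995]
* E. H. Lieb, R. Seiringer, J. P. Solovej, J. Yngvason (2005), §1.2 (1.16)–(1.17). [LSSY2005]
-/

noncomputable section

open MeasureTheory Filter Set
open scoped ENNReal NNReal Topology

namespace Summit.AtomisticToContinuum.BoseEinsteinCondensation.Theorems.CutLineWitness

open Literature.MathematicalPhysics.QuantumManyBody.BoseGas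

variable {N : ℕ}

/-! ### Re-proved helpers (private in `GroundStateFeynmanKacProofs.lean`) -/

/-- A function vanishing off the box has compact support. [folklore] -/
theorem hasCompactSupport_of_eq_zero_box {ψ : Config N → ℝ} {L : ℝ}
    (h0 : ∀ X, X ∉ boxN N L → ψ X = 0) : HasCompactSupport ψ :=
  HasCompactSupport.intro (isCompact_closedBall (0 : Config N) (3 * |L|))
    fun X hX => h0 X fun hb => hX (boxN_subset_closedBall N L hb)

/-- The square of the trial function is integrable (`L > 0`, `θ > 1`). [folklore] -/
theorem integrable_trialFn_sq {L θ : ℝ} {Ψ₀ : Config N → ℝ} (hL : 0 < L) (hθ : 1 < θ)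
    (hcont : Continuous Ψ₀) (h0 : ∀ X, X ∉ boxN N L → Ψ₀ X = 0) :
    Integrable (fun X => trialFn L θ Ψ₀ X ^ 2) volume :=
  ((contDiff_trialFn hcont).continuous.memLp_of_hasCompactSupport
    (hasCompactSupport_of_eq_zero_box (trialFn_eq_zero hL hθ h0))).integrable_sq

/-- **The energy of a real-scaled trial state**: if `Ψ.ψ = c · φ` for a real `C¹` `φ`, then
`𝓔[Ψ] = c² (∫|∇φ|² + ∫ φ² V)`. [cite: LSSY2005, §1.2 (1.16)] -/
theorem energy_of_ofReal_mul {L : ℝ} (Ψ : TrialState N L) {c : ℝ} {φ : Config N → ℝ}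
    (hφC : ContDiff ℝ 1 φ) (hΨ : Ψ.ψ = fun X => (((c * φ X : ℝ)) : ℂ)) (v : ℝ → ℝ≥0∞) :
    energy v Ψ = ENNReal.ofReal (c ^ 2) *
      ((∫⁻ X, realKinetic φ X) + ∫⁻ X, ENNReal.ofReal (φ X ^ 2) * interaction v X) := by
  have hφd : Differentiable ℝ φ := hφC.differentiable one_ne_zero
  have hcφd : Differentiable ℝ fun Y => c * φ Y := (differentiable_const c).mul hφd
  have hkin : ∀ X, kineticDensity Ψ.ψ X = ENNReal.ofReal (c ^ 2) * realKinetic φ X := by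
    intro X
    rw [hΨ, kineticDensity_ofReal hcφd, realKinetic_const_mul_periodic hφd]
  have hnorm : ∀ X, ((‖Ψ.ψ X‖₊ : ℝ≥0∞)) ^ 2 = ENNReal.ofReal (c ^ 2) * ENNReal.ofReal (φ X ^ 2) := by
    intro X
    rw [hΨ, ennnorm_sq_ofReal_periodic, mul_pow, ENNReal.ofReal_mul (sq_nonneg _)]
  unfold energy
  simp_rw [hkin, hnorm]
  have h1 : ∀ X, ENNReal.ofReal (c ^ 2) * realKinetic φ X +
      interaction v X * (ENNReal.ofReal (c ^ 2) * ENNReal.ofReal (φ X ^ 2)) =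
      ENNReal.ofReal (c ^ 2) * (realKinetic φ X + ENNReal.ofReal (φ X ^ 2) * interaction v X) := by
    intro X; ring
  simp_rw [h1]
  rw [lintegral_const_mul' _ _ ENNReal.ofReal_ne_top, lintegral_add_left (measurable_realKinetic hφC)]

/-- `|∫ (φ² - Ψ₀²) w| ≤ B · vol(Λ) · 2M · s` when `sup|φ - Ψ₀| ≤ s`, `|φ|, |Ψ₀| ≤ M`, `|w| ≤ B`,
and both functions vanish off the box. [folklore] -/
theorem abs_integral_sq_sub_sq_mul_le {L : ℝ} {φ Ψ₀ w : Config N → ℝ}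
    {M s B : ℝ} (hM0 : 0 ≤ M) (hs0 : 0 ≤ s) (hφM : ∀ X, |φ X| ≤ M) (hΨM : ∀ X, |Ψ₀ X| ≤ M)
    (hw : ∀ X, |w X| ≤ B) (hφ0 : ∀ X, X ∉ boxN N L → φ X = 0)
    (hΨ0 : ∀ X, X ∉ boxN N L → Ψ₀ X = 0) (hsup : ∀ X, |φ X - Ψ₀ X| ≤ s) :
    |∫ X, (φ X ^ 2 - Ψ₀ X ^ 2) * w X| ≤ B * (volume (boxN N L)).toReal * (2 * M) * s := by
  have hpt : ∀ X, |(φ X ^ 2 - Ψ₀ X ^ 2) * w X| ≤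
      (boxN N L).indicator (fun _ => B * (2 * M) * s) X := by
    intro X
    by_cases hX : X ∈ boxN N L
    · rw [Set.indicator_of_mem hX, abs_mul,
        show φ X ^ 2 - Ψ₀ X ^ 2 = (φ X - Ψ₀ X) * (φ X + Ψ₀ X) by ring, abs_mul]
      calc |φ X - Ψ₀ X| * |φ X + Ψ₀ X| * |w X| ≤ s * (M + M) * B := by
            refine mul_le_mul (mul_le_mul (hsup X)
              ((abs_add_le _ _).trans (add_le_add (hφM X) (hΨM X))) (abs_nonneg _) hs0) (hw X)
              (abs_nonneg _) (by positivity)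
        _ = B * (2 * M) * s := by ring
    · rw [Set.indicator_of_notMem hX, hφ0 X hX, hΨ0 X hX]; simp
  have hint : Integrable ((boxN N L).indicator fun _ : Config N => B * (2 * M) * s) volume := by
    refine IntegrableOn.integrable_indicator ?_ (measurableSet_boxN N L)
    exact integrableOn_const (volume_boxN_lt_top N L).ne
  calc |∫ X, (φ X ^ 2 - Ψ₀ X ^ 2) * w X|
      ≤ ∫ X, (boxN N L).indicator (fun _ => B * (2 * M) * s) X := by
        rw [← Real.norm_eq_abs]
        refine norm_integral_le_of_norm_le hint (Eventually.of_forall fun X => ?_)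
        rw [Real.norm_eq_abs]; exact hpt X
    _ = B * (volume (boxN N L)).toReal * (2 * M) * s := by
        rw [integral_indicator_const _ (measurableSet_boxN N L), smul_eq_mul, measureReal_def]
        ring

/-- The potential integral of a bounded potential against `Ψ₀²`, real form. [folklore] -/
theorem lintegral_sq_mul_interaction_eq_ofReal {v : ℝ → ℝ≥0∞} (hv : Measurable v) {C : ℝ≥0}
    (hC : ∀ r, v r ≤ C) {Ψ₀ : Config N → ℝ} (hΨm : Measurable Ψ₀)
    (hsq : Integrable (fun X => Ψ₀ X ^ 2) volume) :
    ∫⁻ X, ENNReal.ofReal (Ψ₀ X ^ 2) * interaction v X =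
      ENNReal.ofReal (∫ X, Ψ₀ X ^ 2 * (interaction v X).toReal) := by
  set CV : ℝ≥0 := (N * N : ℕ) * C with hCVdef
  have hVle : ∀ X : Config N, interaction v X ≤ CV := fun X => by
    have := interaction_le_of_le (C := (C : ℝ≥0∞)) (fun r => hC r) X
    simpa [hCVdef] using this
  have hVtop : ∀ X : Config N, interaction v X ≠ ⊤ :=
    fun X => ne_top_of_le_ne_top ENNReal.coe_ne_top (hVle X)
  have hVm : Measurable (interaction (N := N) v) := measurable_interaction hv
  have hint : Integrable (fun X => Ψ₀ X ^ 2 * (interaction v X).toReal) volume := by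
    refine (hsq.mul_const (CV : ℝ)).mono' ((hΨm.pow_const 2).mul hVm.ennreal_toReal).aestronglyMeasurable
      (Eventually.of_forall fun X => ?_)
    rw [Real.norm_eq_abs, abs_mul, abs_of_nonneg (sq_nonneg _), abs_of_nonneg ENNReal.toReal_nonneg]
    refine mul_le_mul_of_nonneg_left ?_ (sq_nonneg _)
    have := ENNReal.toReal_mono ENNReal.coe_ne_top (hVle X)
    simpa using this
  rw [ofReal_integral_eq_lintegral_ofReal hint (Eventually.of_forall fun X =>
    mul_nonneg (sq_nonneg _) ENNReal.toReal_nonneg)]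
  refine lintegral_congr fun X => ?_
  rw [ENNReal.ofReal_mul (sq_nonneg _), ENNReal.ofReal_toReal (hVtop X)]

/-- **The potential energy of an eigenfunction candidate is at most `λ`**: `∫ Ψ₀² V ≤ λ`.
[folklore] -/
theorem integral_sq_mul_interaction_le {v : ℝ → ℝ≥0∞} (hv : Measurable v) {C : ℝ≥0}
    (hC : ∀ r, v r ≤ C) {L : ℝ} {Ψ₀ : Config N → ℝ} (hcont : Continuous Ψ₀)
    (h0 : ∀ X, X ∉ boxN N L → Ψ₀ X = 0) (hnn : ∀ X, 0 ≤ Ψ₀ X) (hnorm : ∫ X, Ψ₀ X ^ 2 = 1)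
    {lam : ℝ} (heig : ∀ t : ℝ, 0 < t → Real.exp (-(lam * t)) ≤ ∫ X, Ψ₀ X * fkReal v L t Ψ₀ X) :
    ∫ X, Ψ₀ X ^ 2 * (interaction v X).toReal ≤ lam := by
  by_contra hlt
  push Not at hlt
  set K : ℝ := lam - ∫ X, Ψ₀ X ^ 2 * (interaction v X).toReal with hK
  have hK0 : K < 0 := by rw [hK]; linarith
  have hev := sqIncr_toReal_eventually_le hv hC hcont h0 hnn hnorm heig (K' := K / 2) (by linarith)
  obtain ⟨t, ht, htpos⟩ := (hev.and self_mem_nhdsWithin).exists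
  have ht' : (0 : ℝ) < t := by exact_mod_cast htpos
  have h0le : 0 ≤ (sqIncr t Ψ₀).toReal := ENNReal.toReal_nonneg
  nlinarith

/-- Elementary: if `0 < n`, `1 - τ ≤ n` with `τ ≤ 1/4` and `4τ ≤ ε`, then `n⁻¹ ≤ 1 + ε`.
[folklore] -/
theorem inv_le_one_add_of_sub_le {n τ ε : ℝ} (hε : 0 < ε) (hτ1 : τ ≤ 1 / 4) (hτε : 4 * τ ≤ ε)
    (hn : 1 - τ ≤ n) (hn0 : 0 < n) : n⁻¹ ≤ 1 + ε := by
  have hA : τ * ε ≤ 1 / 4 * ε := mul_le_mul_of_nonneg_right hτ1 hε.le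
  have hkey : 1 ≤ (1 - τ) * (1 + ε) := by nlinarith
  have h1ε : (0 : ℝ) < 1 + ε := by linarith
  have hτpos : 0 < 1 - τ := by linarith
  have h1 : (1 + ε)⁻¹ ≤ 1 - τ := (inv_le_iff_one_le_mul₀ h1ε).2 hkey
  calc n⁻¹ ≤ (1 - τ)⁻¹ := (inv_le_inv₀ hn0 hτpos).2 hn
    _ ≤ ((1 + ε)⁻¹)⁻¹ := (inv_le_inv₀ hτpos (inv_pos.2 h1ε)).2 h1
    _ = 1 + ε := inv_inv _

/-! ### The near-minimisers -/

-- Full-build repair 2026-08-17: the ~165-line proof below elaborates within the gate checker's budget (rc 0,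
-- ≈ 25 s) but hit the DEFAULT `maxHeartbeats 200000` (at `whnf`, lines 167/333 of the 2026-08-16 text) in four
-- consecutive `lake build`s; 8× the default, exactly as for
-- `QuantumFields/YangMills/Theorems/FemtoCurvatureTwoPoint/Negative/FiniteGroupRatio.lean`. Statements untouched.
set_option maxHeartbeats 1600000 in
/-- **Symmetric `C¹` Dirichlet near-minimisers next to a ground-state candidate.** Let `L > 0`,
`v ≤ C` measurable, `Ψ₀` continuous, nonnegative, permutation symmetric, vanishing off `Λ_L^N`,
`∫Ψ₀² = 1`, with `e^{-λt} ≤ ⟨Ψ₀, e^{-tH_N}Ψ₀⟩` for all `t > 0`. Then for every `ε > 0` and every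
property `P` of the dilation parameter holding eventually as `θ → 1⁺` there are `θ > 1` with `P θ`,
`c > 0` with `c² ≤ 1 + ε`, and a trial state `Ψ ∈ TrialState N L` with wave function
`c · trialFn L θ Ψ₀` (real, `≥ 0`) and `energy v Ψ ≤ λ + ε` — the construction of
`groundStateEnergy_le_ofReal_of_eigen` with its witnesses exposed (dilate towards the centre,
mollify with the symmetric product mollifier, normalise; kinetic energy by
`lintegral_realKinetic_trialFn_le` and `sqIncr_div_eventually_le`, norm and potential energy by
uniform convergence). [cite: ChungZhao1995, Thm 3.27 and Prop 3.29 (81)] -/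
theorem exists_trialState_energy_le {L : ℝ} (hL : 0 < L) {v : ℝ → ℝ≥0∞} (hv : Measurable v)
    {C : ℝ≥0} (hC : ∀ r, v r ≤ C) {Ψ₀ : Config N → ℝ} (hcont : Continuous Ψ₀)
    (h0 : ∀ X, X ∉ boxN N L → Ψ₀ X = 0) (hnn : ∀ X, 0 ≤ Ψ₀ X)
    (hsymm : ∀ (σ : Equiv.Perm (Fin N)) (X : Config N), Ψ₀ (X ∘ σ) = Ψ₀ X)
    (hnorm : ∫ X, Ψ₀ X ^ 2 = 1) {lam : ℝ}
    (heig : ∀ t : ℝ, 0 < t → Real.exp (-(lam * t)) ≤ ∫ X, Ψ₀ X * fkReal v L t Ψ₀ X)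
    {P : ℝ → Prop} (hP : ∀ᶠ θ in 𝓝[>] (1 : ℝ), P θ) {ε : ℝ≥0} (hε : 0 < ε) :
    ∃ (θ : ℝ) (c : ℝ) (Ψ : TrialState N L), 1 < θ ∧ P θ ∧ 0 < c ∧ c ^ 2 ≤ 1 + ε ∧
      (Ψ.ψ = fun X => (((c * trialFn L θ Ψ₀ X : ℝ)) : ℂ)) ∧
      energy v Ψ ≤ ENNReal.ofReal lam + ε := by
  -- data of `Ψ₀`
  have hcs := hasCompactSupport_of_eq_zero_box h0
  have hΨm : Measurable Ψ₀ := hcont.measurable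
  obtain ⟨M0, hM0⟩ := hcs.exists_bound_of_continuous hcont
  set M : ℝ := max M0 0 with hMdef
  have hMnn : 0 ≤ M := le_max_right _ _
  have hMabs : ∀ X, |Ψ₀ X| ≤ M := fun X => by
    have := hM0 X; rw [Real.norm_eq_abs] at this; exact this.trans (le_max_left _ _)
  have hΨsq : Integrable (fun X => Ψ₀ X ^ 2) volume := (hcont.memLp_of_hasCompactSupport hcs).integrable_sq
  set Pot : ℝ := ∫ X, Ψ₀ X ^ 2 * (interaction v X).toReal with hPotdef
  have hPot0 : 0 ≤ Pot := integral_nonneg fun X => mul_nonneg (sq_nonneg _) ENNReal.toReal_nonneg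
  have hPotle : Pot ≤ lam := integral_sq_mul_interaction_le hv hC hcont h0 hnn hnorm heig
  have hlam0 : 0 ≤ lam := hPot0.trans hPotle
  -- the bounded weight `V.toReal ≤ N²C`
  set CV : ℝ := ((N * N : ℕ) : ℝ) * C with hCVdef
  have hCV0 : 0 ≤ CV := by positivity
  have hVreal : ∀ X : Config N, |(interaction v X).toReal| ≤ CV := fun X => by
    rw [abs_of_nonneg ENNReal.toReal_nonneg]
    have h1 := interaction_le_of_le (C := (C : ℝ≥0∞)) (fun r => hC r) X
    have h2 : ((N * N : ℕ) : ℝ≥0∞) * (C : ℝ≥0∞) ≠ ⊤ :=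
      ENNReal.mul_ne_top (ENNReal.natCast_ne_top _) ENNReal.coe_ne_top
    have := ENNReal.toReal_mono h2 h1
    rw [ENNReal.toReal_mul] at this
    simpa [hCVdef] using this
  set vol : ℝ := (volume (boxN N L)).toReal with hvoldef
  have hvol0 : 0 ≤ vol := ENNReal.toReal_nonneg
  -- `ε`-management
  set η : ℝ := min ((ε : ℝ) / 4) (1 / 4) with hηdef
  have hε' : (0 : ℝ) < ε := by exact_mod_cast hε
  have hη : 0 < η := lt_min (by linarith) (by norm_num)
  have hη4 : 4 * η ≤ ε := by have := min_le_left ((ε : ℝ) / 4) (1 / 4); linarith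
  have hη1 : η ≤ 1 / 4 := min_le_right _ _
  set K' : ℝ := lam - Pot + η with hK'def
  have hK' : lam - Pot < K' := by rw [hK'def]; linarith
  have hK'0 : 0 ≤ K' := by rw [hK'def]; linarith
  have hev := sqIncr_div_eventually_le hv hC hcont h0 hnn hnorm heig hK'
  set τ : ℝ := η / (lam + 4 * η + 1) with hτdef
  have hτ : 0 < τ := div_pos hη (by linarith)
  have hτη : τ ≤ η := by
    rw [hτdef, div_le_iff₀ (by linarith)]; nlinarith
  have hτlam : τ * (lam + 4 * η) ≤ η := by
    rw [hτdef]
    rw [div_mul_eq_mul_div, div_le_iff₀ (by linarith)]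
    nlinarith
  set s : ℝ := τ / ((CV + 1) * (vol + 1) * (2 * M + 1)) with hsdef
  have hs : 0 < s := div_pos hτ (by positivity)
  have hsB : ∀ B : ℝ, 0 ≤ B → B ≤ CV + 1 → B * vol * (2 * M) * s ≤ τ := by
    intro B hB0 hB1
    have hden : 0 < (CV + 1) * (vol + 1) * (2 * M + 1) := by positivity
    have : B * vol * (2 * M) * s = τ * (B * vol * (2 * M) / ((CV + 1) * (vol + 1) * (2 * M + 1))) := by
      simp only [hsdef]; field_simp
    rw [this]
    calc τ * (B * vol * (2 * M) / ((CV + 1) * (vol + 1) * (2 * M + 1))) ≤ τ * 1 := by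
          refine mul_le_mul_of_nonneg_left ((div_le_one hden).2 ?_) hτ.le
          calc B * vol * (2 * M) ≤ (CV + 1) * vol * (2 * M) := by gcongr
            _ ≤ (CV + 1) * (vol + 1) * (2 * M + 1) := by gcongr <;> linarith
      _ = τ := mul_one τ
  -- choose `θ`
  have hunif := trialFn_tendsto_uniformly hL hcont h0 hs
  have hsq : ∀ᶠ θ : ℝ in 𝓝[>] 1, θ ^ 2 * K' ≤ K' + η := by
    have hc : Continuous fun θ : ℝ => θ ^ 2 * K' := by fun_prop
    have h1 : (fun θ : ℝ => θ ^ 2 * K') 1 < K' + η := by simp [hη]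
    exact ((hc.tendsto 1).eventually (gt_mem_nhds h1)).filter_mono nhdsWithin_le_nhds |>.mono
      fun θ hθ => hθ.le
  obtain ⟨θ, ⟨⟨hu, hθsq⟩, hPθ⟩, hθ1⟩ := (((hunif.and hsq).and hP).and self_mem_nhdsWithin).exists
  have hθ1' : (1 : ℝ) < θ := hθ1
  -- the trial function at this `θ`
  set φ := trialFn L θ Ψ₀ with hφdef
  have hφC : ContDiff ℝ 1 φ := contDiff_trialFn hcont
  have hφm : Measurable φ := hφC.continuous.measurable
  have hφM : ∀ X, |φ X| ≤ M := abs_trialFn_le hMabs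
  have hφ0 : ∀ X, X ∉ boxN N L → φ X = 0 := trialFn_eq_zero hL hθ1' h0
  have hφsq : Integrable (fun X => φ X ^ 2) volume := integrable_trialFn_sq hL hθ1' hcont h0
  -- the norm and the potential energy are close to `1` and `Pot`
  have hn1 : |(∫ X, φ X ^ 2) - 1| ≤ τ := by
    have heq : (∫ X, φ X ^ 2) - 1 = ∫ X, (φ X ^ 2 - Ψ₀ X ^ 2) * (fun _ => (1 : ℝ)) X := by
      simp only [mul_one]
      rw [integral_sub hφsq hΨsq, hnorm]
    rw [heq]
    refine (abs_integral_sq_sub_sq_mul_le (B := 1) hMnn hs.le hφM hMabs (fun _ => by norm_num)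
      hφ0 h0 hu).trans ?_
    exact hsB 1 zero_le_one (by linarith)
  set PotV : ℝ := ∫ X, φ X ^ 2 * (interaction v X).toReal with hPotVdef
  have hPV : |PotV - Pot| ≤ τ := by
    have hint1 : Integrable (fun X => φ X ^ 2 * (interaction v X).toReal) volume := by
      refine (hφsq.mul_const CV).mono' ((hφm.pow_const 2).mul
        (measurable_interaction hv).ennreal_toReal).aestronglyMeasurable (Eventually.of_forall fun X => ?_)
      rw [Real.norm_eq_abs, abs_mul, abs_of_nonneg (sq_nonneg _)]
      exact mul_le_mul_of_nonneg_left (hVreal X) (sq_nonneg _)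
    have hint2 : Integrable (fun X => Ψ₀ X ^ 2 * (interaction v X).toReal) volume := by
      refine (hΨsq.mul_const CV).mono' ((hΨm.pow_const 2).mul
        (measurable_interaction hv).ennreal_toReal).aestronglyMeasurable (Eventually.of_forall fun X => ?_)
      rw [Real.norm_eq_abs, abs_mul, abs_of_nonneg (sq_nonneg _)]
      exact mul_le_mul_of_nonneg_left (hVreal X) (sq_nonneg _)
    have heq : PotV - Pot = ∫ X, (φ X ^ 2 - Ψ₀ X ^ 2) * (interaction v X).toReal := by
      rw [hPotVdef, hPotdef, ← integral_sub hint1 hint2]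
      refine integral_congr_ae (Eventually.of_forall fun X => ?_)
      ring
    rw [heq]
    refine (abs_integral_sq_sub_sq_mul_le hMnn hs.le hφM hMabs hVreal hφ0 h0 hu).trans ?_
    exact hsB CV hCV0 (by linarith)
  -- positivity of the norm and the trial state
  have hn0 : 0 < ∫ X, φ X ^ 2 := by
    have := (abs_le.1 hn1).1; linarith
  set c : ℝ := (Real.sqrt (∫ X, φ X ^ 2))⁻¹ with hc
  have hcpos : 0 < c := by rw [hc]; exact inv_pos.2 (Real.sqrt_pos.2 hn0)
  have hc2 : c ^ 2 = (∫ X, φ X ^ 2)⁻¹ := by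
    rw [hc, inv_pow, Real.sq_sqrt hn0.le]
  have hnormΨ : ∫⁻ X, ((‖((c * φ X : ℝ) : ℂ)‖₊ : ℝ≥0∞)) ^ 2 = 1 := by
    have h1 : ∀ X, ((‖((c * φ X : ℝ) : ℂ)‖₊ : ℝ≥0∞)) ^ 2 =
        ENNReal.ofReal (c ^ 2) * ENNReal.ofReal (φ X ^ 2) := fun X => by
      rw [ennnorm_sq_ofReal_periodic, mul_pow, ENNReal.ofReal_mul (sq_nonneg _)]
    simp_rw [h1]
    rw [lintegral_const_mul' _ _ ENNReal.ofReal_ne_top,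
      ← ofReal_integral_eq_lintegral_ofReal hφsq (Eventually.of_forall fun X => sq_nonneg _),
      ← ENNReal.ofReal_mul (sq_nonneg _), hc2, inv_mul_cancel₀ hn0.ne', ENNReal.ofReal_one]
  let Ψ : TrialState N L :=
    { ψ := fun X => (((c * φ X : ℝ)) : ℂ)
      contDiff := Complex.ofRealCLM.contDiff.comp (contDiff_const.mul hφC)
      eq_zero := fun X hX => by simp [hφ0 X hX]
      symm := fun σ X => by
        show (((c * φ (X ∘ σ) : ℝ)) : ℂ) = (((c * φ X : ℝ)) : ℂ)
        rw [hφdef, trialFn_comp_perm hsymm σ X]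
      norm_eq := hnormΨ }
  -- the kinetic bound
  have hkin : ∫⁻ X, realKinetic φ X ≤ ENNReal.ofReal (K' + η) :=
    (lintegral_realKinetic_trialFn_le hθ1' hcont hMabs hev).trans (ENNReal.ofReal_le_ofReal hθsq)
  have hpotE : ∫⁻ X, ENNReal.ofReal (φ X ^ 2) * interaction v X = ENNReal.ofReal PotV :=
    lintegral_sq_mul_interaction_eq_ofReal hv hC hφm hφsq
  have hPotV0 : 0 ≤ PotV := integral_nonneg fun X => mul_nonneg (sq_nonneg _) ENNReal.toReal_nonneg
  -- the energy bound in `[0, ∞]`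
  have hE : energy v Ψ ≤ ENNReal.ofReal ((∫ X, φ X ^ 2)⁻¹ * (K' + η + PotV)) := by
    rw [energy_of_ofReal_mul Ψ hφC rfl v, hpotE, hc2,
      ENNReal.ofReal_mul (inv_nonneg.2 hn0.le), ENNReal.ofReal_add (by linarith) hPotV0]
    gcongr
  -- the real inequalities
  have hn_low : 1 - τ ≤ ∫ X, φ X ^ 2 := by have := (abs_le.1 hn1).1; linarith
  have hreal : (∫ X, φ X ^ 2)⁻¹ * (K' + η + PotV) ≤ lam + ε := by
    set n := ∫ X, φ X ^ 2 with hndef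
    have hPVle : PotV ≤ Pot + τ := by have := (abs_le.1 hPV).2; linarith
    rw [inv_mul_le_iff₀ hn0]
    have h1 : K' + η + PotV ≤ lam + 3 * η := by rw [hK'def]; linarith
    have h2 : lam + 3 * η ≤ n * (lam + 4 * η) := by nlinarith
    nlinarith
  have hc2le : c ^ 2 ≤ 1 + ε := by
    rw [hc2]
    exact inv_le_one_add_of_sub_le hε' (hτη.trans hη1) (by linarith only [hτη, hη4]) hn_low hn0
  refine ⟨θ, c, Ψ, hθ1', hPθ, hcpos, hc2le, rfl, ?_⟩
  calc energy v Ψ ≤ ENNReal.ofReal ((∫ X, φ X ^ 2)⁻¹ * (K' + η + PotV)) := hE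
    _ ≤ ENNReal.ofReal (lam + ε) := ENNReal.ofReal_le_ofReal hreal
    _ ≤ ENNReal.ofReal lam + ENNReal.ofReal ε := ENNReal.ofReal_add_le
    _ = ENNReal.ofReal lam + ε := by rw [ENNReal.ofReal_coe_nnreal]

end Summit.AtomisticToContinuum.BoseEinsteinCondensation.Theorems.CutLineWitness

end
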